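import Summits.ValiantsHypothesis.ValiantsHypothesis.Theorems.KPlusLogSqLawTridiagonalRealStaticUnitPencil
import Summits.ValiantsHypothesis.ValiantsHypothesis.Theorems.LacunarySymmetroidMatrixDescartesInertiaIndexFormula

/-!
# Route «KPlusLogSqLaw», crux `WeakLifting` (stmt-ValiantsHypothesis-19561) — REAL side of the tridiagonal sector:
# the UNIT-COEFFICIENT sub-sector — recessive-side zeros are of NEGATIVE TYPE; the EXACT WINDOW COUNT (all sizes; unconditional for `m ≤ 8`)
# (file `…UnitSturmWindowCount`; announced in `…UnitPencil` under the working name `…UnitNegativeType`)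

HONEST FRAMING.  Helper theorems (`--supports stmt-ValiantsHypothesis-19561 --as helper`), seat val-sym-lift-p1 (g18), cell `pub-symmetroid`,
2026-08-28.  The BRIDGE from this seat's crossing-direction package (p632571 entropy balance → p633123 law → p633729 kernel vector /
Hellmann–Feynman → p635395 derivative form; pencil bookkeeping `…UnitPencil`) to val-sym-mdr-p2's INERTIA KIT (one-type window law
`Inertia.card_roots_Ioo_add_negIndex_eq_of_negType` of `…MatrixDescartesInertiaIndexFormula`) and val-sym-lift-p2 g15's JACOBI–STURM RULE
(`SturmJacobi.negIndex_eval_eq_sturmCount`).  Continuants `D_k = pathDet (fun _ => 1) d (fun _ => 1) f k`; STURM COUNT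
`V(x) = #{k < m : D_k(x)D_{k+1}(x) < 0}` (= the negative inertia index of the unit path matrix at `x`).  Proved here (all exponents):
* **NEGATIVE TYPE** (`negType_below_one`, all `m ≥ 3`; `negType_below_one_of_le_eight`, no separation hypothesis for `m ≤ 8`): below the
  resonance, all slopes positive, at a zero `t` of `D_m` with `D_1, …, D_{m−1} ≠ 0` (and, for `m ≥ 9`, no two negative pivot products three edges
  apart), EVERY non-zero kernel vector `u` of the evaluated pencil has `P_u′(t) < 0`;
* **EXACT WINDOW COUNT** (`card_roots_window_add_sturm_eq`, all `m ≥ 3`; `card_roots_window_add_sturm_eq_of_le_eight`): all slopes positive,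
  `0 < a < b < 1`, no `D_k` (`k ≤ m`) vanishing at `a`, `b`, every zero of `D_m` in `(a,b)` non-degenerate (and NJAN-free for `m ≥ 9`):
  `#{zeros of D_m in (a,b), with multiplicity} + V(a) = V(b)` — THE NUMBER OF ZEROS IN A WINDOW IS THE DRIFT OF THE STURM COUNT, read off two
  continuant sign tables; all these zeros are simple and each adds one negative eigenvalue.
LOCATED (memo CROSSING-DIRECTION-liftp1g18.md §3): the NJAN hypothesis cannot be dropped from `m = 9` on (explicit integer design with five zeros in
`(0,1)` while `V` drifts by three).  Nothing here is an upper law for the register (α NO MOVER); nothing bears on `WeakLifting` / `TropicalB`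
(stmt-19771) in their windows, Conjecture B, the Door-A registers, `MatrixDescartes` (stmt-18050) or VP ≠ VNP.
[this seat; folklore: definite-type eigenvalue crossings (Gohberg–Lancaster–Rodman), Sturm sequences]
-/

-- `Summit.ValiantsHypothesis.ValiantsHypothesis.…` repeats a component by the D-0017 layout (single-conjunct summit); the name is mandated.
set_option linter.dupNamespace false
set_option autoImplicit false

namespace Summit.ValiantsHypothesis.ValiantsHypothesis.Theorems.KPlusLogSqLaw
namespace StaticTridiagonalRealUnit

open Real Finset Polynomial Matrix
open Summit.ValiantsHypothesis.ValiantsHypothesis.Theorems.KPlusLogSqLaw.StaticTridiagonalRealPotential (pathDet)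

variable (d : ℕ → ℕ) (f : ℕ → ℕ)

/-! ### 1. Negative type from positive slope energy -/

/-- **core**: at a zero `t > 0` of `D_{n+2}`, if the slope-weighted energy `Σ_k (2f_k − d_k − d_{k+1})·e_k` is positive then every non-zero kernel
vector `u` of the evaluated pencil has `P_u′(t) < 0` (kernel = multiples of the continuant vector; `t·P_u′(t) = c²·wᵀ(tJ′)w = −c²·Σ L_k e_k`). [this file] -/
theorem negType_of_slopeEnergy_pos (n : ℕ) (t : ℝ) (ht : 0 < t)
    (hroot : (pathDet (fun _ => (1 : ℝ)) d (fun _ => (1 : ℝ)) f (n + 2)).eval t = 0)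
    (hE : 0 < ∑ k ∈ range (n + 1), ((2 * (f k : ℝ)) - ((d k + d (k + 1) : ℕ) : ℝ)) *
      ((pathDet (fun _ => (1 : ℝ)) d (fun _ => (1 : ℝ)) f k).eval t * (pathDet (fun _ => (1 : ℝ)) d (fun _ => (1 : ℝ)) f (k + 1)).eval t /
        t ^ (2 * ∑ j ∈ range k, f j)))
    (u : Fin (n + 2) → ℝ) (hu : (∑ κ, t ^ unitExponent d f (n + 2) κ • unitLetter (n + 2) κ) *ᵥ u = 0) (hu0 : u ≠ 0) :
    (derivative (∑ κ, C (u ⬝ᵥ (unitLetter (n + 2) κ *ᵥ u)) * (X : ℝ[X]) ^ unitExponent d f (n + 2) κ)).eval t < 0 := by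
  -- the kernel vector is `c • w`
  have hker := kernel_eq_smul d f (n + 2) t ht u hu
  set c := u ⟨0, by omega⟩ with hc
  have hc0 : c ≠ 0 := by
    intro h0
    apply hu0
    funext i
    rw [show u i = u ⟨(i : ℕ), i.isLt⟩ from rfl, hker (i : ℕ) i.isLt, ← hc, h0, zero_mul]
    rfl
  have hray := rayleigh_derivative_eval d f (n + 2) u t
  have hdot := dot_pencil (n + 2) (by omega) (fun κ => ((unitExponent d f (n + 2) κ : ℝ) * t ^ unitExponent d f (n + 2) κ)) u
    (fun j => c * ((-1) ^ j * (pathDet (fun _ => (1 : ℝ)) d (fun _ => (1 : ℝ)) f j).eval t / t ^ (∑ i ∈ range j, f i)))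
    (fun j => (d j : ℝ) * t ^ d j) (fun j => (f j : ℝ) * t ^ f j)
    (fun a => by rw [show u a = u ⟨(a : ℕ), a.isLt⟩ from rfl, hker (a : ℕ) a.isLt]) (fun _ => rfl) (fun _ => rfl)
  rw [show n + 2 - 1 = n + 1 from rfl] at hdot
  have hQ := quadForm_eq_neg_slopeEnergy d f n t ht hroot
  have hA : ∑ j ∈ range (n + 2), (d j : ℝ) * t ^ d j *
      (c * ((-1) ^ j * (pathDet (fun _ => (1 : ℝ)) d (fun _ => (1 : ℝ)) f j).eval t / t ^ (∑ i ∈ range j, f i))) ^ 2 =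
      c ^ 2 * ∑ i ∈ range (n + 2), (d i : ℝ) * (t ^ d i *
        ((-1) ^ i * (pathDet (fun _ => (1 : ℝ)) d (fun _ => (1 : ℝ)) f i).eval t / t ^ (∑ j ∈ range i, f j)) ^ 2) := by
    rw [mul_sum]; exact sum_congr rfl fun i _ => by ring
  have hB : ∑ j ∈ range (n + 1), (f j : ℝ) * t ^ f j *
      (c * ((-1) ^ j * (pathDet (fun _ => (1 : ℝ)) d (fun _ => (1 : ℝ)) f j).eval t / t ^ (∑ i ∈ range j, f i))) *
      (c * ((-1) ^ (j + 1) * (pathDet (fun _ => (1 : ℝ)) d (fun _ => (1 : ℝ)) f (j + 1)).eval t / t ^ (∑ i ∈ range (j + 1), f i))) =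
      c ^ 2 * ∑ k ∈ range (n + 1), (f k : ℝ) * (t ^ f k *
        ((-1) ^ k * (pathDet (fun _ => (1 : ℝ)) d (fun _ => (1 : ℝ)) f k).eval t / t ^ (∑ j ∈ range k, f j)) *
        ((-1) ^ (k + 1) * (pathDet (fun _ => (1 : ℝ)) d (fun _ => (1 : ℝ)) f (k + 1)).eval t / t ^ (∑ j ∈ range (k + 1), f j))) := by
    rw [mul_sum]; exact sum_congr rfl fun k _ => by ring
  have hval : t * (derivative (∑ κ, C (u ⬝ᵥ (unitLetter (n + 2) κ *ᵥ u)) * (X : ℝ[X]) ^ unitExponent d f (n + 2) κ)).eval t =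
      c ^ 2 * -∑ k ∈ range (n + 1), ((2 * (f k : ℝ)) - ((d k + d (k + 1) : ℕ) : ℝ)) *
        ((pathDet (fun _ => (1 : ℝ)) d (fun _ => (1 : ℝ)) f k).eval t * (pathDet (fun _ => (1 : ℝ)) d (fun _ => (1 : ℝ)) f (k + 1)).eval t /
          t ^ (2 * ∑ j ∈ range k, f j)) := by
    rw [hray, hdot, ← hQ, hA, hB]; ring
  have hneg : t * (derivative (∑ κ, C (u ⬝ᵥ (unitLetter (n + 2) κ *ᵥ u)) * (X : ℝ[X]) ^ unitExponent d f (n + 2) κ)).eval t < 0 := by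
    rw [hval]
    have hc2 : 0 < c ^ 2 := by positivity
    nlinarith
  by_contra hcon
  exact absurd hneg (not_lt.2 (mul_nonneg ht.le (not_lt.1 hcon)))

/-! ### 2. Negative type of the recessive-side zeros -/

/-- **NEGATIVE TYPE (all sizes `m ≥ 3`)**: below the resonance, all slopes positive, at a zero `t` of `D_m` with `D_1, …, D_{m−1}` non-zero and
no two negative pivot products three edges apart, every non-zero kernel vector `u` of the evaluated pencil has `P_u′(t) < 0`. [this file] -/
theorem negType_below_one (m : ℕ) (hm : 3 ≤ m) (t : ℝ) (ht : 0 < t) (ht1 : t < 1)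
    (hslope : ∀ k, k + 1 < m → d k + d (k + 1) < 2 * f k)
    (hroot : (pathDet (fun _ => (1 : ℝ)) d (fun _ => (1 : ℝ)) f m).eval t = 0)
    (hnd : ∀ k, 0 < k → k < m → (pathDet (fun _ => (1 : ℝ)) d (fun _ => (1 : ℝ)) f k).eval t ≠ 0)
    (hsep : ∀ k, k + 4 < m →
      (pathDet (fun _ => (1 : ℝ)) d (fun _ => (1 : ℝ)) f k).eval t * (pathDet (fun _ => (1 : ℝ)) d (fun _ => (1 : ℝ)) f (k + 1)).eval t < 0 →
      0 < (pathDet (fun _ => (1 : ℝ)) d (fun _ => (1 : ℝ)) f (k + 3)).eval t * (pathDet (fun _ => (1 : ℝ)) d (fun _ => (1 : ℝ)) f (k + 4)).eval t)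
    (u : Fin m → ℝ) (hu : (∑ κ, t ^ unitExponent d f m κ • unitLetter m κ) *ᵥ u = 0) (hu0 : u ≠ 0) :
    (derivative (∑ κ, C (u ⬝ᵥ (unitLetter m κ *ᵥ u)) * (X : ℝ[X]) ^ unitExponent d f m κ)).eval t < 0 := by
  have hE := slopeEnergy_pos_below_one d f m hm t ht ht1 hslope hroot hnd hsep
  obtain ⟨n, rfl⟩ : ∃ n, m = n + 2 := ⟨m - 2, by omega⟩
  rw [show n + 2 - 1 = n + 1 from rfl] at hE
  exact negType_of_slopeEnergy_pos d f n t ht hroot hE u hu hu0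

/-- **NEGATIVE TYPE (`3 ≤ m ≤ 8`, no separation hypothesis)**: below the resonance, all slopes positive, at a zero `t` of `D_m` with
`D_1, …, D_{m−1}` non-zero, every non-zero kernel vector `u` of the evaluated pencil has `P_u′(t) < 0` — the zero is of negative type in the
sense of `…MatrixDescartesInertiaIndexFormula`. [this file] -/
theorem negType_below_one_of_le_eight (m : ℕ) (hm : 3 ≤ m) (hm8 : m ≤ 8) (t : ℝ) (ht : 0 < t) (ht1 : t < 1)
    (hslope : ∀ k, k + 1 < m → d k + d (k + 1) < 2 * f k)
    (hroot : (pathDet (fun _ => (1 : ℝ)) d (fun _ => (1 : ℝ)) f m).eval t = 0)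
    (hnd : ∀ k, 0 < k → k < m → (pathDet (fun _ => (1 : ℝ)) d (fun _ => (1 : ℝ)) f k).eval t ≠ 0)
    (u : Fin m → ℝ) (hu : (∑ κ, t ^ unitExponent d f m κ • unitLetter m κ) *ᵥ u = 0) (hu0 : u ≠ 0) :
    (derivative (∑ κ, C (u ⬝ᵥ (unitLetter m κ *ᵥ u)) * (X : ℝ[X]) ^ unitExponent d f m κ)).eval t < 0 := by
  have hbal := slopeEnergy_balance_pos_of_le_eight d f m hm hm8 t ht
    (fun k hk => pow_lt_pow_right_of_lt_one₀ ht ht1 (hslope k hk)) hroot hnd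
  obtain ⟨n, rfl⟩ : ∃ n, m = n + 2 := ⟨m - 2, by omega⟩
  rw [show n + 2 - 1 = n + 1 by omega] at hbal
  have hlog : log t < 0 := log_neg ht ht1
  have hE : 0 < ∑ k ∈ range (n + 1), ((2 * (f k : ℝ)) - ((d k + d (k + 1) : ℕ) : ℝ)) *
      ((pathDet (fun _ => (1 : ℝ)) d (fun _ => (1 : ℝ)) f k).eval t * (pathDet (fun _ => (1 : ℝ)) d (fun _ => (1 : ℝ)) f (k + 1)).eval t /
        t ^ (2 * ∑ j ∈ range k, f j)) := by
    have hrw : ∑ k ∈ range (n + 1), (((d k + d (k + 1) : ℕ) : ℝ) - 2 * (f k : ℝ)) * log t *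
        ((pathDet (fun _ => (1 : ℝ)) d (fun _ => (1 : ℝ)) f k).eval t * (pathDet (fun _ => (1 : ℝ)) d (fun _ => (1 : ℝ)) f (k + 1)).eval t /
          t ^ (2 * ∑ j ∈ range k, f j)) = (-log t) * ∑ k ∈ range (n + 1), ((2 * (f k : ℝ)) - ((d k + d (k + 1) : ℕ) : ℝ)) *
        ((pathDet (fun _ => (1 : ℝ)) d (fun _ => (1 : ℝ)) f k).eval t * (pathDet (fun _ => (1 : ℝ)) d (fun _ => (1 : ℝ)) f (k + 1)).eval t /
          t ^ (2 * ∑ j ∈ range k, f j)) := by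
      rw [mul_sum]; exact sum_congr rfl fun k _ => by ring
    rw [hrw] at hbal
    exact (pos_iff_pos_of_mul_pos hbal).1 (by linarith)
  exact negType_of_slopeEnergy_pos d f n t ht hroot hE u hu hu0

/-! ### 3. The exact window count -/

/-- transport of the negative index along an equality of matrices. [bookkeeping] -/
theorem negIndex_congr {ι : Type} [Fintype ι] [DecidableEq ι] {A B : Matrix ι ι ℝ} (h : A = B) (hA : A.IsHermitian) (hB : B.IsHermitian) :
    Fintype.card {j // hA.eigenvalues j < 0} = Fintype.card {j // hB.eigenvalues j < 0} := by
  subst h; rfl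

/-- **EXACT WINDOW COUNT (`3 ≤ m ≤ 8`, all exponents)**: all slopes positive, `0 < a < b < 1`, no `D_k` (`k ≤ m`) vanishing at `a` or `b`, every
zero of `D_m` in `(a, b)` non-degenerate (`D_1, …, D_{m−1} ≠ 0` there).  Then the zeros of `D_m` in `(a, b)` COUNTED WITH MULTIPLICITY number exactly
the drift of the Sturm count: `#zeros + V(a) = V(b)`, `V(x) = #{k < m : D_k(x)D_{k+1}(x) < 0}`. [this file] -/
theorem card_roots_window_add_sturm_eq_of_le_eight (m : ℕ) (hm : 3 ≤ m) (hm8 : m ≤ 8) {a b : ℝ} (ha0 : 0 < a) (hab : a < b) (hb1 : b < 1)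
    (hslope : ∀ k, k + 1 < m → d k + d (k + 1) < 2 * f k)
    (ha : ∀ k, k ≤ m → (pathDet (fun _ => (1 : ℝ)) d (fun _ => (1 : ℝ)) f k).eval a ≠ 0)
    (hb : ∀ k, k ≤ m → (pathDet (fun _ => (1 : ℝ)) d (fun _ => (1 : ℝ)) f k).eval b ≠ 0)
    (hnd : ∀ t, a < t → t < b → (pathDet (fun _ => (1 : ℝ)) d (fun _ => (1 : ℝ)) f m).eval t = 0 →
      ∀ k, 0 < k → k < m → (pathDet (fun _ => (1 : ℝ)) d (fun _ => (1 : ℝ)) f k).eval t ≠ 0) :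
    Multiset.card ((pathDet (fun _ => (1 : ℝ)) d (fun _ => (1 : ℝ)) f m).roots.filter (fun t => a < t ∧ t < b)) +
        (Finset.univ.filter fun k : Fin m =>
          (pathDet (fun _ => (1 : ℝ)) d (fun _ => (1 : ℝ)) f k).eval a * (pathDet (fun _ => (1 : ℝ)) d (fun _ => (1 : ℝ)) f (k + 1)).eval a < 0).card =
      (Finset.univ.filter fun k : Fin m =>
          (pathDet (fun _ => (1 : ℝ)) d (fun _ => (1 : ℝ)) f k).eval b * (pathDet (fun _ => (1 : ℝ)) d (fun _ => (1 : ℝ)) f (k + 1)).eval b < 0).card := by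
  classical
  have hS := unitLetter_isSymm m
  -- determinant of the evaluated pencil = `D_m`
  have hdet : ∀ x : ℝ, (∑ κ, x ^ unitExponent d f m κ • unitLetter m κ).det = (pathDet (fun _ => (1 : ℝ)) d (fun _ => (1 : ℝ)) f m).eval x := by
    intro x
    rw [unitPencil_eq_ctPath, Summit.ValiantsHypothesis.ValiantsHypothesis.Theorems.KPlusLogSqLaw.SturmJacobi.det_evalPath]
  have hwin := Summit.ValiantsHypothesis.ValiantsHypothesis.Theorems.LacunarySymmetroidMatrixDescartes.Inertia.card_roots_Ioo_add_negIndex_eq_of_negType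
    (unitExponent d f m) (unitLetter m) hS hab (by rw [hdet]; exact ha m le_rfl) (by rw [hdet]; exact hb m le_rfl)
    (fun t hat htb hdt u hu hu0 => negType_below_one_of_le_eight d f m hm hm8 t (ha0.trans hat) (htb.trans hb1) hslope
      (by rw [← hdet]; exact hdt) (hnd t hat htb (by rw [← hdet]; exact hdt)) u hu hu0)
  obtain ⟨h1, -⟩ := hwin
  rw [det_unitPencil] at h1
  -- negative indices = Sturm counts (lift-p2 g15)
  have hνa := Summit.ValiantsHypothesis.ValiantsHypothesis.Theorems.KPlusLogSqLaw.SturmJacobi.negIndex_eval_eq_sturmCount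
    (fun _ => (1 : ℝ)) d (fun _ => (1 : ℝ)) f m (x := a) ha
  have hνb := Summit.ValiantsHypothesis.ValiantsHypothesis.Theorems.KPlusLogSqLaw.SturmJacobi.negIndex_eval_eq_sturmCount
    (fun _ => (1 : ℝ)) d (fun _ => (1 : ℝ)) f m (x := b) hb
  have ea : Fintype.card {j // (Summit.ValiantsHypothesis.ValiantsHypothesis.Theorems.LacunarySymmetroidMatrixDescartes.Inertia.isHermitian_pencil
      (unitExponent d f m) (unitLetter m) hS a).eigenvalues j < 0} =
      (Finset.univ.filter fun k : Fin m =>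
        (pathDet (fun _ => (1 : ℝ)) d (fun _ => (1 : ℝ)) f k).eval a * (pathDet (fun _ => (1 : ℝ)) d (fun _ => (1 : ℝ)) f (k + 1)).eval a < 0).card := by
    rw [negIndex_congr (unitPencil_eq_ctPath d f m a) _
      (Summit.ValiantsHypothesis.ValiantsHypothesis.Theorems.KPlusLogSqLaw.SturmJacobi.ctPathSymm_isHermitian _ _ m)]
    exact hνa
  have eb : Fintype.card {j // (Summit.ValiantsHypothesis.ValiantsHypothesis.Theorems.LacunarySymmetroidMatrixDescartes.Inertia.isHermitian_pencil
      (unitExponent d f m) (unitLetter m) hS b).eigenvalues j < 0} =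
      (Finset.univ.filter fun k : Fin m =>
        (pathDet (fun _ => (1 : ℝ)) d (fun _ => (1 : ℝ)) f k).eval b * (pathDet (fun _ => (1 : ℝ)) d (fun _ => (1 : ℝ)) f (k + 1)).eval b < 0).card := by
    rw [negIndex_congr (unitPencil_eq_ctPath d f m b) _
      (Summit.ValiantsHypothesis.ValiantsHypothesis.Theorems.KPlusLogSqLaw.SturmJacobi.ctPathSymm_isHermitian _ _ m)]
    exact hνb
  rw [ea, eb] at h1
  exact h1

/-- **EXACT WINDOW COUNT (all sizes `m ≥ 3`, all exponents)**: all slopes positive, `0 < a < b < 1`, no `D_k` (`k ≤ m`) vanishing at `a` or `b`,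
every zero of `D_m` in `(a, b)` non-degenerate and without two negative pivot products three edges apart.  Then the zeros of `D_m` in `(a, b)` COUNTED WITH MULTIPLICITY number exactly
the drift of the Sturm count: `#zeros + V(a) = V(b)`, `V(x) = #{k < m : D_k(x)D_{k+1}(x) < 0}`. [this file] -/
theorem card_roots_window_add_sturm_eq (m : ℕ) (hm : 3 ≤ m) {a b : ℝ} (ha0 : 0 < a) (hab : a < b) (hb1 : b < 1)
    (hslope : ∀ k, k + 1 < m → d k + d (k + 1) < 2 * f k)
    (ha : ∀ k, k ≤ m → (pathDet (fun _ => (1 : ℝ)) d (fun _ => (1 : ℝ)) f k).eval a ≠ 0)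
    (hb : ∀ k, k ≤ m → (pathDet (fun _ => (1 : ℝ)) d (fun _ => (1 : ℝ)) f k).eval b ≠ 0)
    (hnd : ∀ t, a < t → t < b → (pathDet (fun _ => (1 : ℝ)) d (fun _ => (1 : ℝ)) f m).eval t = 0 →
      ∀ k, 0 < k → k < m → (pathDet (fun _ => (1 : ℝ)) d (fun _ => (1 : ℝ)) f k).eval t ≠ 0)
    (hsep : ∀ t, a < t → t < b → (pathDet (fun _ => (1 : ℝ)) d (fun _ => (1 : ℝ)) f m).eval t = 0 → ∀ k, k + 4 < m →
      (pathDet (fun _ => (1 : ℝ)) d (fun _ => (1 : ℝ)) f k).eval t * (pathDet (fun _ => (1 : ℝ)) d (fun _ => (1 : ℝ)) f (k + 1)).eval t < 0 →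
      0 < (pathDet (fun _ => (1 : ℝ)) d (fun _ => (1 : ℝ)) f (k + 3)).eval t * (pathDet (fun _ => (1 : ℝ)) d (fun _ => (1 : ℝ)) f (k + 4)).eval t) :
    Multiset.card ((pathDet (fun _ => (1 : ℝ)) d (fun _ => (1 : ℝ)) f m).roots.filter (fun t => a < t ∧ t < b)) +
        (Finset.univ.filter fun k : Fin m =>
          (pathDet (fun _ => (1 : ℝ)) d (fun _ => (1 : ℝ)) f k).eval a * (pathDet (fun _ => (1 : ℝ)) d (fun _ => (1 : ℝ)) f (k + 1)).eval a < 0).card =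
      (Finset.univ.filter fun k : Fin m =>
          (pathDet (fun _ => (1 : ℝ)) d (fun _ => (1 : ℝ)) f k).eval b * (pathDet (fun _ => (1 : ℝ)) d (fun _ => (1 : ℝ)) f (k + 1)).eval b < 0).card := by
  classical
  have hS := unitLetter_isSymm m
  -- determinant of the evaluated pencil = `D_m`
  have hdet : ∀ x : ℝ, (∑ κ, x ^ unitExponent d f m κ • unitLetter m κ).det = (pathDet (fun _ => (1 : ℝ)) d (fun _ => (1 : ℝ)) f m).eval x := by
    intro x
    rw [unitPencil_eq_ctPath, Summit.ValiantsHypothesis.ValiantsHypothesis.Theorems.KPlusLogSqLaw.SturmJacobi.det_evalPath]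
  have hwin := Summit.ValiantsHypothesis.ValiantsHypothesis.Theorems.LacunarySymmetroidMatrixDescartes.Inertia.card_roots_Ioo_add_negIndex_eq_of_negType
    (unitExponent d f m) (unitLetter m) hS hab (by rw [hdet]; exact ha m le_rfl) (by rw [hdet]; exact hb m le_rfl)
    (fun t hat htb hdt u hu hu0 => negType_below_one d f m hm t (ha0.trans hat) (htb.trans hb1) hslope
      (by rw [← hdet]; exact hdt) (hnd t hat htb (by rw [← hdet]; exact hdt)) (hsep t hat htb (by rw [← hdet]; exact hdt)) u hu hu0)
  obtain ⟨h1, -⟩ := hwin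
  rw [det_unitPencil] at h1
  -- negative indices = Sturm counts (lift-p2 g15)
  have hνa := Summit.ValiantsHypothesis.ValiantsHypothesis.Theorems.KPlusLogSqLaw.SturmJacobi.negIndex_eval_eq_sturmCount
    (fun _ => (1 : ℝ)) d (fun _ => (1 : ℝ)) f m (x := a) ha
  have hνb := Summit.ValiantsHypothesis.ValiantsHypothesis.Theorems.KPlusLogSqLaw.SturmJacobi.negIndex_eval_eq_sturmCount
    (fun _ => (1 : ℝ)) d (fun _ => (1 : ℝ)) f m (x := b) hb
  have ea : Fintype.card {j // (Summit.ValiantsHypothesis.ValiantsHypothesis.Theorems.LacunarySymmetroidMatrixDescartes.Inertia.isHermitian_pencil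
      (unitExponent d f m) (unitLetter m) hS a).eigenvalues j < 0} =
      (Finset.univ.filter fun k : Fin m =>
        (pathDet (fun _ => (1 : ℝ)) d (fun _ => (1 : ℝ)) f k).eval a * (pathDet (fun _ => (1 : ℝ)) d (fun _ => (1 : ℝ)) f (k + 1)).eval a < 0).card := by
    rw [negIndex_congr (unitPencil_eq_ctPath d f m a) _
      (Summit.ValiantsHypothesis.ValiantsHypothesis.Theorems.KPlusLogSqLaw.SturmJacobi.ctPathSymm_isHermitian _ _ m)]
    exact hνa
  have eb : Fintype.card {j // (Summit.ValiantsHypothesis.ValiantsHypothesis.Theorems.LacunarySymmetroidMatrixDescartes.Inertia.isHermitian_pencil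
      (unitExponent d f m) (unitLetter m) hS b).eigenvalues j < 0} =
      (Finset.univ.filter fun k : Fin m =>
        (pathDet (fun _ => (1 : ℝ)) d (fun _ => (1 : ℝ)) f k).eval b * (pathDet (fun _ => (1 : ℝ)) d (fun _ => (1 : ℝ)) f (k + 1)).eval b < 0).card := by
    rw [negIndex_congr (unitPencil_eq_ctPath d f m b) _
      (Summit.ValiantsHypothesis.ValiantsHypothesis.Theorems.KPlusLogSqLaw.SturmJacobi.ctPathSymm_isHermitian _ _ m)]
    exact hνb
  rw [ea, eb] at h1
  exact h1

/-! ### 4. Below a scale: the zeros in `(0, b)` are counted by the Sturm count at `b` (`m ≤ 8`) -/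

/-- **small scales are positive**: with all slopes positive and `0 < x ≤ 1/4`, every continuant satisfies `x^{d_k}D_k(x) ≤ 2·D_{k+1}(x)` and
`D_{k+1}(x) > 0` (all pivots are at least `1/2`). [this file] -/
theorem continuant_pos_of_le_quarter (m : ℕ) (x : ℝ) (hx : 0 < x) (hx4 : x ≤ 1 / 4)
    (hslope : ∀ k, k + 1 < m → d k + d (k + 1) < 2 * f k) :
    ∀ k, k < m → 0 < (pathDet (fun _ => (1 : ℝ)) d (fun _ => (1 : ℝ)) f (k + 1)).eval x ∧
      x ^ d k * (pathDet (fun _ => (1 : ℝ)) d (fun _ => (1 : ℝ)) f k).eval x ≤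
        2 * (pathDet (fun _ => (1 : ℝ)) d (fun _ => (1 : ℝ)) f (k + 1)).eval x := by
  intro k
  induction k with
  | zero =>
    intro _
    obtain ⟨e0, e1⟩ := eval_unit_zero_one d f x
    rw [e0, e1]
    refine ⟨pow_pos hx _, by nlinarith [pow_pos hx (d 0)]⟩
  | succ k ih =>
    intro hk
    obtain ⟨hpos, hle⟩ := ih (by omega)
    have hrec := eval_unit_add_two d f x k
    have hL := hslope k (by omega)
    -- `x^{2f_k} = x^{d_k + d_{k+1}} · x^{L_k}` with `x^{L_k} ≤ x ≤ 1/4`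
    have hsplit : x ^ (2 * f k) = x ^ d k * x ^ d (k + 1) * x ^ (2 * f k - (d k + d (k + 1))) := by
      rw [← pow_add, ← pow_add]; congr 1; omega
    have hsmall : x ^ (2 * f k - (d k + d (k + 1))) ≤ 1 / 4 := by
      calc x ^ (2 * f k - (d k + d (k + 1))) ≤ x ^ 1 := pow_le_pow_of_le_one hx.le (by linarith) (by omega)
        _ ≤ 1 / 4 := by rw [pow_one]; exact hx4
    have hxd : 0 < x ^ d (k + 1) := pow_pos hx _
    have hxk : 0 < x ^ d k := pow_pos hx _
    rw [show k + 1 + 1 = k + 2 by omega, hrec, hsplit]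
    have hDk : x ^ d k * (pathDet (fun _ => (1 : ℝ)) d (fun _ => (1 : ℝ)) f k).eval x * x ^ (2 * f k - (d k + d (k + 1))) ≤
        2 * (pathDet (fun _ => (1 : ℝ)) d (fun _ => (1 : ℝ)) f (k + 1)).eval x * (1 / 4) := by
      rcases le_or_gt 0 ((pathDet (fun _ => (1 : ℝ)) d (fun _ => (1 : ℝ)) f k).eval x) with h0 | h0
      · exact mul_le_mul hle hsmall (pow_nonneg hx.le _) (by linarith)
      · nlinarith [mul_pos hxk (neg_pos.2 h0), pow_nonneg hx.le (2 * f k - (d k + d (k + 1)))]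
    constructor
    · nlinarith
    · nlinarith

/-- **ZEROS BELOW A SCALE = STURM COUNT AT THAT SCALE (`3 ≤ m ≤ 8`, all exponents)**: all slopes positive, `0 < b < 1` with no `D_k` (`k ≤ m`)
vanishing at `b`, and every zero of `D_m` in `(0, b)` non-degenerate.  Then the zeros of `D_m` in `(0, b)` counted with multiplicity number EXACTLY
`V(b) = #{k < m : D_k(b)D_{k+1}(b) < 0}`. [this file] -/
theorem card_roots_below_eq_sturm_of_le_eight (m : ℕ) (hm : 3 ≤ m) (hm8 : m ≤ 8) {b : ℝ} (hb0 : 0 < b) (hb1 : b < 1)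
    (hslope : ∀ k, k + 1 < m → d k + d (k + 1) < 2 * f k)
    (hb : ∀ k, k ≤ m → (pathDet (fun _ => (1 : ℝ)) d (fun _ => (1 : ℝ)) f k).eval b ≠ 0)
    (hnd : ∀ t, 0 < t → t < b → (pathDet (fun _ => (1 : ℝ)) d (fun _ => (1 : ℝ)) f m).eval t = 0 →
      ∀ k, 0 < k → k < m → (pathDet (fun _ => (1 : ℝ)) d (fun _ => (1 : ℝ)) f k).eval t ≠ 0) :
    Multiset.card ((pathDet (fun _ => (1 : ℝ)) d (fun _ => (1 : ℝ)) f m).roots.filter (fun t => 0 < t ∧ t < b)) =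
      (Finset.univ.filter fun k : Fin m =>
          (pathDet (fun _ => (1 : ℝ)) d (fun _ => (1 : ℝ)) f k).eval b * (pathDet (fun _ => (1 : ℝ)) d (fun _ => (1 : ℝ)) f (k + 1)).eval b < 0).card := by
  -- the small scale `a = b/4`
  set a := b / 4 with ha_def
  have ha0 : 0 < a := by rw [ha_def]; positivity
  have ha4 : a ≤ 1 / 4 := by rw [ha_def]; linarith
  have hab : a < b := by rw [ha_def]; linarith
  have hposA : ∀ x, 0 < x → x ≤ a → ∀ k, k ≤ m → 0 < (pathDet (fun _ => (1 : ℝ)) d (fun _ => (1 : ℝ)) f k).eval x := by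
    intro x hx hxa k hk
    rcases Nat.eq_zero_or_pos k with rfl | hk0
    · rw [(eval_unit_zero_one d f x).1]; exact one_pos
    · obtain ⟨k', rfl⟩ : ∃ k', k = k' + 1 := ⟨k - 1, by omega⟩
      exact (continuant_pos_of_le_quarter d f m x hx (hxa.trans ha4) hslope k' (by omega)).1
  have hwin := card_roots_window_add_sturm_eq_of_le_eight d f m hm hm8 ha0 hab hb1 hslope
    (fun k hk => (hposA a ha0 le_rfl k hk).ne') hb (fun t hat htb => hnd t (ha0.trans hat) htb)
  -- the Sturm count at `a` vanishes
  have hVa : (Finset.univ.filter fun k : Fin m =>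
      (pathDet (fun _ => (1 : ℝ)) d (fun _ => (1 : ℝ)) f k).eval a * (pathDet (fun _ => (1 : ℝ)) d (fun _ => (1 : ℝ)) f (k + 1)).eval a < 0).card = 0 := by
    rw [Finset.card_eq_zero, Finset.filter_eq_empty_iff]
    intro k _
    exact not_lt.2 (mul_pos (hposA a ha0 le_rfl k (by omega)) (hposA a ha0 le_rfl (k + 1) (by omega))).le
  -- no zeros in `(0, a]`
  have hfilt : (pathDet (fun _ => (1 : ℝ)) d (fun _ => (1 : ℝ)) f m).roots.filter (fun t => 0 < t ∧ t < b) =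
      (pathDet (fun _ => (1 : ℝ)) d (fun _ => (1 : ℝ)) f m).roots.filter (fun t => a < t ∧ t < b) := by
    refine Multiset.filter_congr fun t ht => ⟨fun h => ⟨?_, h.2⟩, fun h => ⟨ha0.trans h.1, h.2⟩⟩
    by_contra hle
    have hroot : (pathDet (fun _ => (1 : ℝ)) d (fun _ => (1 : ℝ)) f m).eval t = 0 := (mem_roots'.1 ht).2
    exact (hposA t h.1 (not_lt.1 hle) m le_rfl).ne' hroot
  rw [hfilt, ← hwin, hVa, add_zero]

end StaticTridiagonalRealUnit
end Summit.ValiantsHypothesis.ValiantsHypothesis.Theorems.KPlusLogSqLaw
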